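import Summits.BirchSwinnertonDyer.BirchSwinnertonDyer.Theorems.Rank1ResidualJetCoreVertexExistenceOfNamedPrint
import Summits.BirchSwinnertonDyer.BirchSwinnertonDyer.Theorems.Rank1ResidualJetModPProp44
import HarnessLib

/-!
# T1 JET road K WITHOUT the `p`-adic tower — part 10: Prop. 5.3 (core vertices) at every level above m_infty, from named print
# (width seat `bsd-wall-soed-p2-w2` g5; `--supports`, helper)

Series note (see `Rank1ResidualJetModPCebotarev`, part 1): the road-K end forms
`JET.jetchevDivisibilityCarrier{Ne,Mult,Add}_of_swapLiterature` (Jetchev 2008 Thm. 1.4 at a bad prime `p ∣ N`,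
cell `bsd-jet`) carry the `p`-adic tower binder although every leaf use in their cone is `htower 1`; at `p = 3`
the tower does not follow from `ρ̄₃` onto (Elkies 2006) and the SOED crux of record Ko′ (stmt-24696) is
tower-free. This file re-issues, decl by decl (suffix `_modP`, same namespace, proof text = the original with
`htower 1 ↦ hsurj`, McCallum's Cor. 3.2 / Prop. 4.4 fed by their mod-`p` derivations of parts 1–2), the
following decl(s) of `Rank1ResidualJetCoreVertexExistenceOfNamedPrint` with `(hsurj : W.HasSurjectiveModNGaloisRep p)` in place of the
tower. Nothing of `bsd-jet`'s is edited. HONEST FRAMING: theorems only, CONDITIONAL on the displayed hypotheses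
(named print: Poitou–Tate for Selmer structures, [GZ86 III (3.1)], Gross 1991 Prop. 3.7 (2) where they occur);
no new definition, no named fact, no `sorry`; BSD is not proved by this file.
References: [cite: Jetchev2008, Thm. 1.4, Prop. 4.9, Lemma 5.1, Thm. 5.2, Prop. 5.3 (pp. 812–824)]
[cite: McCallumLMS1991, §3 Cor. 3.2, §4 Prop. 4.4, §5 Prop. 5.2] [cite: GrossLMS1991, Prop. 3.7 (2), §6]
[cite: Cha2005, Thm. 3, Thm. 7] [cite: Elkies2006, Introduction].
-/

set_option autoImplicit false

noncomputable section

open scoped Classical NumberField Pointwise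

namespace Summit.BirchSwinnertonDyer.Rank1Residual.X11b.Three.Koly

open WeierstrassCurve IsDedekindDomain NumberField Literature.NumberTheory.EllipticCurves
  Literature.NumberTheory.EllipticCurves.ModularForms Literature.NumberTheory.GaloisRepresentations
  Summit.BirchSwinnertonDyer.Rank1Residual.JET

/-- (mod-`p` twin of `exists_data_h47Base_of_prop44`: the `p`-adic tower binder replaced by `ρ̄_{E,p}` onto; proof text otherwise that of the original.) **`h47` of the based ordered walk, DISCHARGED modulo McCallum Prop. 4.4.** For `W` non-CM, `K`
imaginary quadratic with `d_K < −4` and the Heegner hypothesis, `p` odd with the `p`-adic tower, a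
frame `(Dt, β, ι)`, a level `p^k` (`k ≥ 1`) and ANY datum `d` at an admissible conductor `n`: there
is a data system `D` on the admissible-conductor subtype with `D n = d` such that for every multiple
`s` of `n`, every prime `ℓ ∤ s` above all prime factors of `s` with `sℓ` admissible, and `λ ∋ ℓ`, the
localisations at `λ` of `c_k(sℓ)` and `c_k(s)` have the same order — the hypothesis `h47` of
`Koly.tamagawaExponent_le_m_of_orderedFamiliesBase` VERBATIM (`c := n`). The data are Gross's one
system of choices built by `Walk.exists_basedFamily_of_primeStep` from bsd-jet's compatible one-step
extension; the comparison is the typed Prop. 4.4 (`h44`, print, hypothesis).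
[cite: McCallumLMS1991, §4 Prop. 4.4 (p. 301)] [cite: GrossLMS1991, §3 (pp. 238–239), §4 (4.1)]
[cite: Jetchev2008, Prop. 4.4 (p. 821)] -/
theorem exists_data_h47Base_of_prop44_modP
    (h372 : GrossLMS1991.prop37_2_frobeniusCongruence)
    (W : WeierstrassCurve ℚ) [W.IsElliptic] [W.IsGloballyMinimal] [NeZero (W.conductorNorm ℤ)]
    (hcm : ¬ W.HasCM) {K : Type} [Field K] [NumberField K] (hK : IsImaginaryQuadratic K)
    (hD : NumberField.discr K < -4) (hH : SatisfiesHeegnerHypothesis (W.conductorNorm ℤ) K)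
    {p : ℕ} [Fact p.Prime] (hp2 : p ≠ 2) (hsurj : W.HasSurjectiveModNGaloisRep p)
    (Dt : ModularParametrizationData W (W.conductorNorm ℤ)) (β : ℤ) (ι : K →+* ℂ) {k : ℕ} (hk : 1 ≤ k)
    {n : ℕ} (hn : Squarefree n ∧ ∀ q ∈ n.primeFactors,
      Zhang2014.IsKolyvaginPrime (W.conductorNorm ℤ) W K p q ∧ k ≤ Zhang2014.kolyvaginIndex W p q)
    (d : KolyvaginHeegnerData Dt β ι n) :
    ∃ D : ∀ s : {m : ℕ // Squarefree m ∧ ∀ q ∈ m.primeFactors,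
        Zhang2014.IsKolyvaginPrime (W.conductorNorm ℤ) W K p q ∧ k ≤ Zhang2014.kolyvaginIndex W p q},
        KolyvaginHeegnerData Dt β ι s.1, D ⟨n, hn⟩ = d ∧
      ∀ (s s' : {m : ℕ // Squarefree m ∧ ∀ q ∈ m.primeFactors,
        Zhang2014.IsKolyvaginPrime (W.conductorNorm ℤ) W K p q ∧ k ≤ Zhang2014.kolyvaginIndex W p q})
        (ℓ : ℕ), ℓ.Prime → ¬ ℓ ∣ s.1 → s'.1 = s.1 * ℓ → (∀ q ∈ s.1.primeFactors, q < ℓ) → n ∣ s.1 →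
      ∀ v : HeightOneSpectrum (𝓞 K), (ℓ : 𝓞 K) ∈ v.asIdeal →
      addOrderOf (galoisCohomology.localization ((W.baseChange K).torsionGaloisModule ((p ^ k : ℕ) : ℤ))
          (Sum.inr v) 1 ((D s').kolyvaginClass (Fact.out : p.Prime) k)) =
        addOrderOf (galoisCohomology.localization ((W.baseChange K).torsionGaloisModule ((p ^ k : ℕ) : ℤ))
          (Sum.inr v) 1 ((D s).kolyvaginClass (Fact.out : p.Prime) k)) := by
  haveI : ∀ j : ℕ, NumberField (ringClassField K ι j) := numberField_ringClassField K hK ι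
  have hD3 : NumberField.discr K ≠ -3 := by omega
  have hD4 : NumberField.discr K ≠ -4 := by omega
  -- the based family of compatible data
  obtain ⟨D, hDn, hR⟩ := Walk.exists_basedFamily_of_primeStep
    (data := fun m ↦ KolyvaginHeegnerData Dt β ι m)
    (fun m ↦ Squarefree m ∧ ∀ q ∈ m.primeFactors,
      Zhang2014.IsKolyvaginPrime (W.conductorNorm ℤ) W K p q ∧ k ≤ Zhang2014.kolyvaginIndex W p q)
    (R := fun {a b} (dc : KolyvaginHeegnerData Dt β ι a) (d' : KolyvaginHeegnerData Dt β ι b) ↦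
      (∀ l' ∈ a.primeFactors, ∀ (x : ringClassField K ι a) (x' : ringClassField K ι b),
        (x : ℂ) = x' → ((d'.σ l' x' : ringClassField K ι b) : ℂ) = (dc.σ l' x : ℂ)) ∧
      (∀ t ∈ dc.S, ∃ t' ∈ d'.S, ∀ (x : ringClassField K ι a) (x' : ringClassField K ι b),
        (x : ℂ) = x' → ((t' x' : ringClassField K ι b) : ℂ) = (t x : ℂ)) ∧
      (∀ t' ∈ d'.S, ∃ t ∈ dc.S, ∀ (x : ringClassField K ι a) (x' : ringClassField K ι b),
        (x : ℂ) = x' → ((t' x' : ringClassField K ι b) : ℂ) = (t x : ℂ)) ∧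
      (∀ (x : ringClassField K ι a) (x' : ringClassField K ι b),
        (x : ℂ) = x' → d'.emb x' = dc.emb x))
    (fun m h ↦ h.1) (fun m m' h hm' ↦ ⟨h.1.squarefree_of_dvd hm', fun q hq ↦
      h.2 q (Nat.primeFactors_mono hm' h.1.ne_zero hq)⟩)
    (fun m h ↦ BirchSwinnertonDyer.Theorems.nonempty_kolyvaginHeegnerData_of_grossCM
      (phi_heegnerPointOfConductor_mem_range_map_ringClassField_holds _ W K)
      exists_generator_ringClassGalOver_holds hK hH Dt β ι d.dvd_sq_sub h.1
      (fun q hq ↦ (h.2 q hq).1.2.2.2.2.1))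
    (fun c ℓ dc hA hℓ ↦ by
      have hc0 : c * ℓ ≠ 0 := hA.1.ne_zero
      obtain ⟨hcop, hc, -⟩ := Nat.squarefree_mul_iff.mp hA.1
      have hcK : ∀ q ∈ c.primeFactors, Zhang2014.IsKolyvaginPrime (W.conductorNorm ℤ) W K p q :=
        fun q hq ↦ (hA.2 q (Nat.primeFactors_mono (dvd_mul_right c ℓ) hc0 hq)).1
      have hKol : Zhang2014.IsKolyvaginPrime (W.conductorNorm ℤ) W K p ℓ :=
        (hA.2 ℓ (Nat.mem_primeFactors.mpr ⟨hℓ, dvd_mul_left ℓ c, hc0⟩)).1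
      have hℓc : ℓ ∉ c.primeFactors := fun h ↦
        (Nat.Prime.coprime_iff_not_dvd hℓ).mp hcop.symm (Nat.dvd_of_mem_primeFactors h)
      obtain ⟨dℓ, hdℓ⟩ := exists_compatible_data_of_grossCM
        (phi_heegnerPointOfConductor_mem_range_map_ringClassField_holds _ W K) hK hD hH p Dt β ι hc
        hcK dc
      exact ⟨dℓ ℓ hKol hℓc, hdℓ ℓ hKol hℓc⟩)
    hn d
  refine ⟨D, hDn, ?_⟩
  intro s s' ℓ hℓ hℓs hs' hlt hns v hv
  obtain ⟨hσ, hS1, hS2, hemb⟩ := hR s s' ℓ hℓ hℓs hs' hlt hns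
  -- transport the datum at `s'` along `s'.1 = s.1 * ℓ`
  obtain ⟨m', hm'⟩ := s'
  change m' = s.1 * ℓ at hs'
  subst hs'
  exact addOrderOf_localization_kolyvaginClass_mul_eq_of_prop44_modP h372 W hcm K hK hD3 hD4 hH p hp2 hsurj
    Dt β ι k hk s.1 ℓ hm'.1 hℓ hℓs hm'.2 (D s) (D ⟨s.1 * ℓ, hm'⟩) hσ hS1 hS2 hemb v hv

end Summit.BirchSwinnertonDyer.Rank1Residual.X11b.Three.Koly

namespace Summit.BirchSwinnertonDyer.Rank1Residual.JET

open WeierstrassCurve IsDedekindDomain NumberField Field Literature.NumberTheory.EllipticCurves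
  Literature.NumberTheory.EllipticCurves.ModularForms Literature.NumberTheory.EllipticCurves.Jetchev2008
  Literature.NumberTheory.EllipticCurves.KolyvaginCocycle
  Literature.NumberTheory.GaloisRepresentations Literature.NumberTheory.GaloisCohomology
  Literature.NumberTheory.GaloisRepresentations.DiscreteGaloisModule
  Summit.BirchSwinnertonDyer.Rank1Residual.X11b Summit.BirchSwinnertonDyer.Rank1Residual.X11b.Three
  Summit.BirchSwinnertonDyer.Rank1Residual.X11b.Three.Koly
  Summit.BirchSwinnertonDyer.Rank1Residual.JET.SelmerVocabulary Literature.NumberTheory.Automorphic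

set_option maxHeartbeats 800000 in
/-- (mod-`p` twin of `jetchevCoreVertexExistence_lt_of_namedPrint`: the `p`-adic tower binder replaced by `ρ̄_{E,p}` onto; proof text otherwise that of the original.) **K5 at every level `m > m(c)` from NAMED PRINT ONLY** — the body of `JET.JetchevCoreVertexExistence`
(Jetchev 2008 Prop. 5.3 read at `p ∣ N`: for `c ∈ Λ` with a datum of exact depth `s = m(c)`,
`s + m ≤ M(c)`, there is a core vertex `c' ∈ Λ_{m+s}` for `m` — `IsGlobalCoreVertex` — with a datum of
conductor `c'` whose derived point is of infinite order and not `p^{s+1}`-divisible), with the extra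
premise `s < m`, follows from [McC] Prop. 4.4 (`h44`), Poitou–Tate duality for Selmer structures
(`hPT`) and [GZ86 III (3.1)] in the receptacle form at square-free Kolyvagin conductors (`hGZ`, the
guarded scoped schema of the «named print only» END FORMS). PROOF: the kernel walk, see the module
docstring. [cite: Jetchev2008, Prop. 5.3 (p. 823), proof pp. 823–824] [cite: McCallumLMS1991, §3 Cor. 3.2, §4 Prop. 4.4]
[cite: GrossLMS1991, Prop. 5.4, Prop. 6.2 (1)] [cite: GrossZagier1986, III (3.1)] -/
theorem jetchevCoreVertexExistence_lt_of_namedPrint_modP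
    (h372 : GrossLMS1991.prop37_2_frobeniusCongruence)
    (hPT : ∀ (K : Type) [Field K] [NumberField K], poitouTate_selmerStructure_duality_conj K)
    (hGZ : ∀ (W : WeierstrassCurve ℚ) [W.IsElliptic] [W.IsGloballyMinimal] [NeZero (W.conductorNorm ℤ)]
      (K : Type) [Field K] [NumberField K], IsImaginaryQuadratic K →
      NumberField.discr K ≠ -3 → NumberField.discr K ≠ -4 →
      SatisfiesHeegnerHypothesis (W.conductorNorm ℤ) K →
      ∀ (p : ℕ) [Fact p.Prime], p ≠ 2 → W.HasSurjectiveModNGaloisRep p →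
      ∀ (Dt : ModularParametrizationData W (W.conductorNorm ℤ)) (β : ℤ) (ι : K →+* ℂ)
      [∀ j : ℕ, NumberField (ringClassField K ι j)],
      ∃ n' : ℤ, IsCoprime (p : ℤ) n' ∧ ∀ (m : ℕ), Squarefree m →
        (∀ q ∈ m.primeFactors, Zhang2014.IsKolyvaginPrime (W.conductorNorm ℤ) W K p q) →
        ∀ (dm : KolyvaginHeegnerData Dt β ι m)
        (γ : ringClassField K ι m ≃ₐ[ℚ] ringClassField K ι m), γ ∈ ringClassGal ι m →
        ∀ v : HeightOneSpectrum (𝓞 K), ¬ (W.baseChange K).HasGoodReductionAt v →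
          n' • pointsMap (W.baseChange K) (v.adicCompletion K)
              (dm.toGeomPoints (pointGalHom W (ringClassField K ι m) γ dm.y)) ∈
            E0Receptacle (W.baseChange K) v ∧
          ∀ (ℓ : ℕ), ℓ ∈ m.primeFactors → ∀ (dm' : KolyvaginHeegnerData Dt β ι (m / ℓ))
            (hle : ringClassField K ι (m / ℓ) ≤ ringClassField K ι m),
            n' • pointsMap (W.baseChange K) (v.adicCompletion K)
                (dm.toGeomPoints (pointGalHom W (ringClassField K ι m) γ
                  (WeierstrassCurve.Affine.Point.map (W' := W)
                    ((RingClassField.inclusion ι hle).restrictScalars ℚ) dm'.y))) ∈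
              E0Receptacle (W.baseChange K) v) :
    ∀ (W : WeierstrassCurve ℚ) [W.IsElliptic] [W.IsGloballyMinimal] [NeZero (W.conductorNorm ℤ)],
      ¬ W.HasCM →
      ∀ (K : Type) [Field K] [NumberField K], IsImaginaryQuadratic K →
      NumberField.discr K ≠ -3 → NumberField.discr K ≠ -4 →
      SatisfiesHeegnerHypothesis (W.conductorNorm ℤ) K →
      ∀ (τ : K ≃ₐ[ℚ] K), τ ≠ 1 →
      ∀ (p : ℕ) [Fact p.Prime], p ≠ 2 → W.HasSurjectiveModNGaloisRep p →
      ∀ (Dt : ModularParametrizationData W (W.conductorNorm ℤ)) (β : ℤ) (ι : K →+* ℂ)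
        [∀ k : ℕ, NumberField (ringClassField K ι k)]
        (d₁ : KolyvaginHeegnerData Dt β ι 1), ¬ IsOfFinAddOrder d₁.derivedPoint →
      ∀ (m : ℕ), 1 ≤ m →
      ∀ (c : ℕ) (d : KolyvaginHeegnerData Dt β ι c), Squarefree c →
        (∀ ℓ ∈ c.primeFactors, Zhang2014.IsKolyvaginPrime (W.conductorNorm ℤ) W K p ℓ) →
      ∀ (s : ℕ), s < m → ¬ IsOfFinAddOrder d.derivedPoint →
        (∃ Q : (W.baseChange (ringClassField K ι c)).toAffine.Point,
          ((p ^ s : ℕ) : ℤ) • Q = d.derivedPoint) →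
        (¬ ∃ Q : (W.baseChange (ringClassField K ι c)).toAffine.Point,
          ((p ^ (s + 1) : ℕ) : ℤ) • Q = d.derivedPoint) →
        ((s + m : ℕ) : ℕ∞) ≤ Zhang2014.levelIndex W p c →
        ∃ (c' : ℕ) (d' : KolyvaginHeegnerData Dt β ι c'), Squarefree c' ∧
          (∀ ℓ ∈ c'.primeFactors, Zhang2014.IsKolyvaginPrime (W.conductorNorm ℤ) W K p ℓ ∧
            m + s ≤ Zhang2014.kolyvaginIndex W p ℓ) ∧
          IsGlobalCoreVertex W K ι τ p m c' ∧
          ¬ IsOfFinAddOrder d'.derivedPoint ∧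
          ¬ ∃ Q : (W.baseChange (ringClassField K ι c')).toAffine.Point,
            ((p ^ (s + 1) : ℕ) : ℤ) • Q = d'.derivedPoint := by
  intro W _ _ _ hcm K _ _ hK hD3 hD4 hH τ hτ p _ hp2 hsurj Dt β ι _ _d₁ _hy k hk c d hcsq hcKol s hsk
    _hnt hdvd hndvd hsM
  have hp : p.Prime := Fact.out
  have hρ : W.HasSurjectiveModNGaloisRep p := hsurj
  have hD : NumberField.discr K < -4 := KolyvaginAssembly.discr_lt_neg_four hK ⟨hD3, hD4⟩
  have hND : IsCoprime ((W.conductorNorm ℤ : ℕ) : ℤ) (NumberField.discr K) :=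
    KolyvaginAssembly.isCoprime_discr_of_satisfiesHeegnerHypothesis hK hH
  have hτ2 : τ * τ = 1 := Walk.algEquiv_mul_self_eq_one hK τ hτ
  haveI : NeZero (p ^ k) := ⟨pow_ne_zero k hp.ne_zero⟩
  haveI : Finite (geomTorsion (W.baseChange K) ((p ^ k : ℕ) : ℤ)) :=
    finite_geomTorsion_of_neZero (W.baseChange K) (p ^ k)
  -- `c` is admissible at level `k`: every prime factor has index `≥ s + k ≥ k`
  have hsM' : ((k + s : ℕ) : ℕ∞) ≤ Zhang2014.levelIndex W p c := by rw [Nat.add_comm]; exact hsM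
  have hcidx : ∀ q ∈ c.primeFactors, k + s ≤ Zhang2014.kolyvaginIndex W p q :=
    Zhang2014.natCast_le_levelIndex_iff.mp hsM'
  have hc : Squarefree c ∧ ∀ q ∈ c.primeFactors,
      Zhang2014.IsKolyvaginPrime (W.conductorNorm ℤ) W K p q ∧ k ≤ Zhang2014.kolyvaginIndex W p q :=
    ⟨hcsq, fun q hq ↦ ⟨hcKol q hq, le_trans (Nat.le_add_right k s) (hcidx q hq)⟩⟩
  -- [GZ86 III (3.1)] at this frame (scoped schema), Gross Prop. 5.3 BY NAME, the sign function
  obtain ⟨n', hcop', hGZ'⟩ := hGZ W K hK hD3 hD4 hH p hp2 hρ Dt β ι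
  obtain ⟨ε, hε, h53⟩ := grossProp53_schema_kolyvagin W hK hH p Dt β ι
  obtain ⟨eb, heb, hebε⟩ := Walk.exists_signFunction ε hε
  -- the based data family with Prop. 4.7 along increasing prime chains ([McC] Prop. 4.4)
  obtain ⟨D, hDd, h47⟩ := exists_data_h47Base_of_prop44_modP h372 W hcm hK hD hH hp2 hsurj Dt β ι hk hc d
  -- the global intrinsic transverse family at level `p^k`
  obtain ⟨𝒯, h𝒯, -⟩ := Walk.exists_globalTransverseFamily W ι ((p ^ k : ℕ) : ℤ)
  -- admissible numbers are divisor-closed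
  have hadm : ∀ (s₀ : {m : ℕ // Squarefree m ∧ ∀ q ∈ m.primeFactors,
      Zhang2014.IsKolyvaginPrime (W.conductorNorm ℤ) W K p q ∧ k ≤ Zhang2014.kolyvaginIndex W p q})
      (m' : ℕ), m' ∣ s₀.1 → Squarefree m' ∧ ∀ q ∈ m'.primeFactors,
      Zhang2014.IsKolyvaginPrime (W.conductorNorm ℤ) W K p q ∧ k ≤ Zhang2014.kolyvaginIndex W p q :=
    fun s₀ m' hm' ↦ ⟨s₀.2.1.squarefree_of_dvd hm',
      fun q hq ↦ s₀.2.2 q (Nat.primeFactors_mono hm' s₀.2.1.ne_zero hq)⟩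
  -- depth bookkeeping at `c`: `m(c) = s < k`, `k + s ≤ M(c)`
  have hdiv : divOrd (D ⟨c, hc⟩) p = (s : ℕ∞) := by
    rw [hDd]; exact divOrd_eq_natCast_of_exact d p hdvd hndvd
  have hsMc : (s : ℕ∞) < Zhang2014.levelIndex W p c := by
    refine lt_of_lt_of_le ?_ hsM'
    exact_mod_cast Nat.lt_add_of_pos_left (Nat.lt_of_lt_of_le Nat.zero_lt_one hk)
  have hmc : (if divOrd (D ⟨c, hc⟩) p < Zhang2014.levelIndex W p c then divOrd (D ⟨c, hc⟩) p
      else (⊤ : ℕ∞)) = (s : ℕ∞) := by rw [hdiv, if_pos hsMc]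
  have h0 : (if divOrd (D ⟨c, hc⟩) p < Zhang2014.levelIndex W p c then divOrd (D ⟨c, hc⟩) p
      else (⊤ : ℕ∞)) < (k : ℕ∞) := by rw [hmc]; exact_mod_cast hsk
  have hMc : (k : ℕ∞) + (if divOrd (D ⟨c, hc⟩) p < Zhang2014.levelIndex W p c then divOrd (D ⟨c, hc⟩) p
      else ⊤) ≤ Zhang2014.levelIndex W p c := by rw [hmc]; exact_mod_cast hsM'
  -- τ-stability of the global family at the places of every admissible conductor (Gross §3 dihedral)
  have h𝒯σ' : ∀ (s₀ : {m : ℕ // Squarefree m ∧ ∀ q ∈ m.primeFactors,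
        Zhang2014.IsKolyvaginPrime (W.conductorNorm ℤ) W K p q ∧ k ≤ Zhang2014.kolyvaginIndex W p q})
      (v w : HeightOneSpectrum (𝓞 K)) (h : τ • v = w), v ∈ placesDividing K s₀.1 →
      ∀ x : galoisCohomology (((W.baseChange K).torsionGaloisModule ((p ^ k : ℕ) : ℤ)).toLocal
        (Sum.inr v : Place K)) 1,
      x ∈ 𝒯 (Sum.inr v) → conjActPlace W τ ((p ^ k : ℕ) : ℤ) h x ∈ 𝒯 (Sum.inr w) :=
    fun s₀ v w h hv x hx ↦ Walk.globalTransverse_conjActPlace_mem h𝒯 τ s₀.2.1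
      (forall_conjActPlace_mem_of_eq_iInf_transverseSubgroup W hK ι τ ((p ^ k : ℕ) : ℤ) s₀.1) v w h hv x hx
  -- ### the FULL kernel walk on the row objects
  have key := exists_coreVertex_of_orderedFamilies W K hK p hp2 hρ
    Dt β ι τ hτ k hk 𝒯 D eb heb c hc h0 hMc ?hdisj ?hPT ?hκt
    (hordκ_of_admissibleData W hK hND hD hp2 hρ Dt β ι k D) h47
  · -- ### read the conclusion in K5's currency
    obtain ⟨s', hcs', hidx', hB, hcyc, hcard, hms'⟩ := key
    have hs0' : s'.1 ≠ 0 := s'.2.1.ne_zero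
    -- `m(s') ≤ s`: finite depth `≤ s` below `M(s')`
    rw [hmc] at hms'
    have hlt' : divOrd (D s') p < Zhang2014.levelIndex W p s'.1 := by
      by_contra h
      rw [if_neg h, top_le_iff] at hms'
      exact ENat.coe_ne_top s hms'
    have hdle : divOrd (D s') p ≤ (s : ℕ∞) := by rwa [if_pos hlt'] at hms'
    have hnd' : ¬ PDiv (D s') p (s + 1) := fun h ↦ by
      have h1 : ((s + 1 : ℕ) : ℕ∞) ≤ (s : ℕ∞) := (le_divOrd_of_pDiv (p := p) (D s') h).trans hdle
      exact absurd (by exact_mod_cast h1 : s + 1 ≤ s) (by omega)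
    -- `P_{s'}` of infinite order: `E(K[s'])` has no `p`-torsion
    have hA : ∀ R : (W.baseChange (ringClassField K ι s'.1)).toAffine.Point, (p : ℤ) • R = 0 → R = 0 :=
      fun R hR ↦ X11b.RingClassNoTorsion.eq_zero_of_zsmul_pow_eq_zero_ringClassField W hK ι hs0' hp hp2
        hρ 1 R (by simpa using hR)
    have hnt' : ¬ IsOfFinAddOrder (D s').derivedPoint :=
      fun hfin ↦ hnd' (exists_pow_smul_eq_of_isOfFinAddOrder hp hA hfin (s + 1))
    -- `H_{𝓕(s')}` in the `modifiedSelmerGroup` currency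
    have hFeq : (selmerF W ((p ^ k : ℕ) : ℤ) 𝒯 (placesDividing K s'.1)).selmerGroup =
        modifiedSelmerGroup W K ι ((p ^ k : ℕ) : ℤ) s'.1 :=
      SelmerVocabulary.selmerGroup_selmerF_eq_modifiedSelmerGroup W ι ((p ^ k : ℕ) : ℤ) 𝒯 hs0'
        (fun x ↦ Walk.globalTransverse_mem_iff h𝒯 s'.2.1 x)
    rw [hFeq] at hB hcyc hcard
    -- the core-vertex package, with the two signs generalised (no dependent rewriting)
    have hpack : ∀ e₁ e₂ : ℤ, e₁ = (if eb s'.1 then (1 : ℤ) else -1) → e₂ = (if !eb s'.1 then (1 : ℤ) else -1) →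
        IsAddCyclic (signPart W K τ ((p ^ k : ℕ) : ℤ) e₁ (modifiedSelmerGroup W K ι ((p ^ k : ℕ) : ℤ) s'.1)) ∧
        Nat.card (signPart W K τ ((p ^ k : ℕ) : ℤ) e₁ (modifiedSelmerGroup W K ι ((p ^ k : ℕ) : ℤ) s'.1)) =
          p ^ k ∧
        signPart W K τ ((p ^ k : ℕ) : ℤ) e₂ (modifiedSelmerGroup W K ι ((p ^ k : ℕ) : ℤ) s'.1) = ⊥ := by
      rintro _ _ rfl rfl
      exact ⟨hcyc, hcard, hB⟩
    refine ⟨s'.1, D s', s'.2.1, fun q hq ↦ ⟨(s'.2.2 q hq).1, ?_⟩, ?_, hnt', hnd'⟩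
    · -- the level clause `c' ∈ Λ_{k+s}`
      rcases hidx' q hq with hqc | hq'
      · exact hcidx q hqc
      · rw [hmc] at hq'
        exact_mod_cast hq'
    · -- the core vertex, sign by sign
      dsimp only [IsGlobalCoreVertex]
      cases hb : eb s'.1
      · obtain ⟨h1, h2, h3⟩ := hpack (-1) 1 (by simp [hb]) (by simp [hb])
        exact Or.inr ⟨h3, h1, h2⟩
      · obtain ⟨h1, h2, h3⟩ := hpack 1 (-1) (by simp [hb]) (by simp [hb])
        exact Or.inl ⟨h1, h2, h3⟩
  case hdisj =>
    -- [J] §4.2 at one completion: `H¹_f ∩ H¹_tr = 0` at a Kolyvagin `λ`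
    intro ℓ hℓK hkℓ _ v hv
    exact Walk.globalTransverse_disjoint_kummer h𝒯
      (P := fun ℓ ↦ Zhang2014.IsKolyvaginPrime (W.conductorNorm ℤ) W K p ℓ)
      (fun ℓ hℓ w hw ↦ Walk.disjoint_kummer_iInf_transverseSubgroup W K hK hD ι k hℓ w hw)
      (fun ℓ hℓ ↦ hℓ.1) ℓ hℓK v hv
  case hPT =>
    -- Lemma 5.2 (iii), primal form, per sign — Poitou–Tate + self-duality of `𝓕(s)`
    intro s₀ ℓ hℓK hkℓ hℓs _ _ w hw b
    obtain ⟨inv, hperf, hvan, -, hSC, hconj⟩ := hPT K (p ^ k)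
    have h2 : 2 ≤ p ^ k := le_trans hp.two_le (Nat.le_self_pow (by omega) p)
    obtain ⟨e, hμ, hadd₁, hadd₂, hgal, halt, hnondeg, hτe⟩ := exists_weilDatum_liftAut W τ (p ^ k) h2
    have hs' : (if b then (1 : ℤ) else -1) = 1 ∨ (if b then (1 : ℤ) else -1) = -1 := by
      cases b <;> simp
    have hℓs' : ℓ ∉ s₀.1.primeFactors := fun h ↦ hℓs (Nat.dvd_of_mem_primeFactors h)
    exact Walk.natCard_map_localization_signPart_relaxedAt W τ p k e hμ hadd₁ hadd₂ hgal halt hnondeg hτe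
      hτ2 hp2 hk inv hperf hvan hSC (hconj τ) 𝒯 s₀.2.1.ne_zero (h𝒯σ' s₀)
      (Walk.globalTransverse_dualTransported_eq (ι := ι) h𝒯 s₀.2.1
        (fun 𝒯c h𝒯c ↦ RingClassTransverse.dualTransported_eq_of_localTransverseFamily W K hK hD ι p hp2 k hk
          s₀.1 s₀.2.1 (fun l hl ↦ (s₀.2.2 l hl).1) (fun l hl ↦ (s₀.2.2 l hl).2) 𝒯c h𝒯c e hμ hadd₁ hadd₂
          hgal halt hnondeg)
        inv hperf)
      hs' (fun ℓ' h1 h2' _ v' hv' hfix ↦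
        GlobalDuality.relIndex_kummer_ker_conjActPlace_eq_pow W K hK (hPT K) hp2 hτ hτ2 hk ℓ' h1 h2' v' hv'
          hfix _ hs')
      ℓ hℓK hkℓ hℓs' w hw
  case hκt =>
    -- §3.1 item 7: the class `κ̃_{s₀}` of a `p^u`-th root of `P_{s₀}`, `u = m(s₀)`
    intro s₀ hcs₀ hs₀
    by_cases hlt : divOrd (D s₀) p < Zhang2014.levelIndex W p s₀.1
    · rw [if_pos hlt] at hs₀ ⊢
      have hne : divOrd (D s₀) p ≠ ⊤ := ne_top_of_lt hlt
      obtain ⟨u, hu⟩ : ∃ u : ℕ, divOrd (D s₀) p = u := ⟨_, (ENat.coe_toNat hne).symm⟩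
      rw [hu] at hs₀ hlt ⊢
      simp only [ENat.toNat_coe]
      have hdvd₀ : PDiv (D s₀) p u := pDiv_of_le_divOrd _ _ _ (le_of_eq hu.symm)
      have hndvd₀ : ¬ PDiv (D s₀) p (u + 1) := fun h ↦ by
        have h' := le_divOrd_of_pDiv (p := p) (D s₀) h
        rw [hu] at h'
        exact absurd (by exact_mod_cast h' : u + 1 ≤ u) (by omega)
      have huk : ((u + k : ℕ) : ℕ∞) ≤ Zhang2014.levelIndex W p s₀.1 := by push_cast; exact hs₀
      have hkol : ∀ q ∈ s₀.1.primeFactors,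
          Zhang2014.IsKolyvaginPrime (W.conductorNorm ℤ) W K p q ∧ k + u ≤ Zhang2014.kolyvaginIndex W p q :=
        fun q hq ↦ ⟨(s₀.2.2 q hq).1, by
          rw [Nat.add_comm]; exact Zhang2014.natCast_le_levelIndex_iff.mp huk q hq⟩
      obtain ⟨hAk, Q, hQ, hQP, hord, hκ⟩ := exists_tildeClass_of_exactDepth_of_surj (Dt := Dt) (β := β)
        hK hND hD hp hp2 hρ hk s₀.2.1 hkol (fun m' hm' ↦ D ⟨m', hadm s₀ m' hm'⟩) hdvd₀ hndvd₀
      -- invariance of `[P_{s₀}]` mod `p^{k+u}` from the data at the divisors of `s₀`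
      have hP : (D s₀).toGeomPoints (D s₀).derivedPoint ∈
          invPoints (absoluteGaloisGroup K) (D s₀).pointsSubgroup ((p ^ (k + u) : ℕ) : ℤ) :=
        KolyCert.toGeomPoints_derivedPoint_mem_invPoints_of_dvd_zhang hK ι Dt hp hND hD s₀.2.1 hkol
          (fun m' hm' ↦ D ⟨m', hadm s₀ m' hm'⟩) s₀.1 dvd_rfl
      -- PURE Selmer membership of the root class: Gross 6.2 (1) mod [GZ86 III (3.1)] at Kolyvagin
      -- conductors (Kummer part, one level up) and Howard's transverseness (one level up)
      have hsel : (kolyvaginClass (W.baseChange K) ((p ^ k : ℕ) : ℤ)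
            ((W.baseChange K).zsmul_geomPoints_surjective_of_charZero
              (by exact_mod_cast pow_ne_zero k hp.ne_zero)) hAk ((D s₀).toGeomPoints Q) hQ :
            galoisCohomology ((W.baseChange K).torsionGaloisModule ((p ^ k : ℕ) : ℤ)) 1) ∈
          (selmerF W ((p ^ k : ℕ) : ℤ) 𝒯 (placesDividing K s₀.1)).selmerGroup := by
        refine (SelmerVocabulary.mem_selmerGroup_selmerF_iff W _ 𝒯 s₀.2.1.ne_zero _).mpr ⟨?_, ?_⟩
        · intro v hv
          refine Walk.localization_rootClass_mem_kummer W hK hp hp2 hρ s₀.2.1.ne_zero (D s₀) k u Q hAk hQ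
            hQP hP v ?_
          exact localization_kolyvaginClass_mem_kummerSelmerStructure_of_GZ31_kolyvagin hK hD3 hD4 hH hp2
            hρ Dt β ι hcop' hGZ' s₀.2.1 hkol (D s₀) v hv
        · exact Walk.localization_rootClass_mem_globalTransverse W h𝒯 hK hp2 hρ s₀.2.1 hkol (D s₀) Q hAk hQ
            hQP hP (fun ℓ hℓ ↦ kolyvaginClass_mem_transverseKer W hK hD hp2 Dt β ι (k + u) s₀.2.1 hkol
              (D s₀) hℓ)
      -- the sign: Gross Prop. 5.4 (1) for the root class, from Prop. 5.3 BY NAME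
      have hsign := conjAct_kolyvaginClass_root_eq_sign_smul_zhang (Dt := Dt) (β := β) hK hp hp2 hρ hND hD
        hk s₀.2.1 hkol (fun m' hm' ↦ D ⟨m', hadm s₀ m' hm'⟩) hτ ε
        (fun m' hm' τm hτm ↦ h53 m' (hadm s₀ m' hm').1 (fun q hq ↦ ((hadm s₀ m' hm').2 q hq).1)
          (D ⟨m', hadm s₀ m' hm'⟩) τm hτm) Q hQP hAk hQ
      refine ⟨_, (mem_signPart_iff W K τ _ _ _ _).mpr ⟨hsel, by rw [hebε]; exact hsign⟩, hord, ?_⟩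
      rw [← natCast_zsmul]
      exact hκ
    · -- degenerate case `M(s₀) = ∞`: then `s₀ = c = 1`, where the given datum has finite depth
      exfalso
      rw [if_neg hlt, top_add, top_le_iff] at hs₀
      have h1 : s₀.1 = 1 := by
        by_contra hne1
        have hlt1 : 1 < s₀.1 :=
          Nat.lt_of_le_of_ne (Nat.one_le_iff_ne_zero.mpr s₀.2.1.ne_zero) (Ne.symm hne1)
        obtain ⟨q, hq⟩ := Nat.nonempty_primeFactors.mpr hlt1
        have hle : Zhang2014.levelIndex W p s₀.1 ≤ (Zhang2014.kolyvaginIndex W p q : ℕ∞) :=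
          Finset.inf_le hq
        rw [hs₀, top_le_iff] at hle
        exact ENat.coe_ne_top _ hle
      have hc1 : c = 1 := Nat.dvd_one.mp (h1 ▸ hcs₀)
      have hs₀c : s₀ = ⟨c, hc⟩ := Subtype.ext (h1.trans hc1.symm)
      refine hlt ?_
      rw [hs₀, hs₀c, hdiv]
      exact ENat.coe_lt_top s

end Summit.BirchSwinnertonDyer.Rank1Residual.JET

end
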